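import Summits.MatrixMultiplication.MatrixMultiplication.Theses.LevelGradedCohnUmans
import Summits.MatrixMultiplication.MatrixMultiplication.Theorems.GradedDesignFamily.Negative.ExponentTwoEndpoint

/-!
# The family Neumann count for simultaneously separated families
# (crux `LevelGradedCohnUmans.GradedDesignFamily`, stmt-MatrixMultiplication-7610; negative side, lead c3)

Let `J ≤ ℂ^G` and let `(X_i, Y_i, Z_i)_{i ∈ ι}` be SIMULTANEOUSLY `J`-SEPARATED in the sense of the
route (for every block `i` and target `(x₀, z₀) ∈ X_i × Z_i` some `f ∈ J` reads
`f(x⁻¹ y y'⁻¹ z) = [a = i ∧ b = i ∧ x = x₀ ∧ y = y' ∧ z = z₀]` for `x ∈ X_a, y ∈ Y_a, y' ∈ Y_b, z ∈ Z_b`),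
with the relevant blocks non-empty.  Write `W_XY = Σ_i |X_i||Y_i|`, `W_YZ = Σ_i |Y_i||Z_i|`,
`W_ZX = Σ_i |Z_i||X_i|`.

* `familyNeumann_Z` — if `J` is LEFT-translation invariant then `W_YZ + W_ZX ≤ dim J + |Z_{i₀}|` for
  every block `i₀`;
* `familyNeumann_X` — if `J` is RIGHT-translation invariant then `W_XY + W_ZX ≤ dim J + |X_{i₀}|`.

For one block these are the two graded Neumann counts of the tree (`packing_X`, `packing_Z`; Neumann
2011 Obs. 3.1 at `J = ⊤`); for families they are new (at `J = ⊤` in an abelian group with singleton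
blocks they say: a tricolored sum-free set has at most `(|A|+1)/2` elements).  PROOF (Z-form): fix
`x₁ ∈ X_{i₀}`, `y₁ ∈ Y_{i₀}`.  The `W_ZX` separators `f_r`, `r = (a, x₀, z₀)`, are linearly independent
in `J` (`separators_linearIndependent`); the `W_YZ` functionals `ψ_c(f) = f(x₁⁻¹ y₁ · y'⁻¹ z)`,
`c = (b, y', z)`, map `J` ONTO `ℂ^C` (hit each coordinate vector by a left translate of a separator);
and the matrix `ψ_c(f_r)` is read off the separation pattern: a partial permutation matrix with exactly
`|Z_{i₀}|` ones (rows `(i₀, x₁, z₀)`, columns `(i₀, y₁, z₀)`).  Rank–nullity on `span{f_r}` gives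
`W_ZX ≤ |Z_{i₀}| + (dim J − W_YZ)` (`rank_core`).  The X-form is the mirror image with right
translates.  Consequences (the three walls sum to `≤ 2 dim J + 1`; tiling efficiency `≤ 2/3 + o(1)`;
the strategist line `tiling-families` is dead) are in `Negative/NoTiling.lean`.

Sorry-free; axioms `propext`, `Classical.choice`, `Quot.sound`.
-/

set_option linter.dupNamespace false

noncomputable section

open scoped BigOperators
open Module Literature.RepresentationTheory.FiniteGroups

namespace Summit.MatrixMultiplication.MatrixMultiplication.Theorems.GradedDesignFamily.Negative

/-! ## Linear-algebra core -/

/-- **Rank core.**  In a finite-dimensional space `V`: `R` linearly independent vectors `f_r`, a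
linear map `Ψ : V → K^C` ONTO `K^C`, and the images `Ψ f_r` all lying in `{0} ∪ {φ_t : t ∈ T}` force
`|R| + |C| ≤ dim V + |T|` (rank–nullity for `Ψ` restricted to `span f`). -/
theorem rank_core {K : Type*} [Field K] {V : Type*} [AddCommGroup V] [Module K V]
    [FiniteDimensional K V] {R C T : Type*} [Fintype R] [Fintype C] [Fintype T]
    (f : R → V) (hf : LinearIndependent K f) (Ψ : V →ₗ[K] (C → K))
    (hΨ : Function.Surjective Ψ) (φ : T → (C → K))
    (hφ : ∀ r, Ψ (f r) = 0 ∨ ∃ t, Ψ (f r) = φ t) :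
    Fintype.card R + Fintype.card C ≤ finrank K V + Fintype.card T := by
  classical
  set U : Submodule K V := Submodule.span K (Set.range f) with hUdef
  have hU : finrank K U = Fintype.card R := finrank_span_eq_card hf
  set Ψ' : U →ₗ[K] (C → K) := Ψ.domRestrict U with hΨ'def
  have hrn := LinearMap.finrank_range_add_finrank_ker Ψ'
  -- (1) the range of `Ψ'` lies in the span of the `φ t`
  have hrange : LinearMap.range Ψ' ≤ Submodule.span K (Set.range φ) := by
    rintro w ⟨u, rfl⟩
    rw [hΨ'def, LinearMap.domRestrict_apply]
    have hmap : U.map Ψ ≤ Submodule.span K (Set.range φ) := by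
      rw [hUdef, Submodule.map_span, Submodule.span_le]
      rintro _ ⟨_, ⟨r, rfl⟩, rfl⟩
      rcases hφ r with h0 | ⟨t, ht⟩
      · rw [h0]; exact Submodule.zero_mem _
      · rw [ht]; exact Submodule.subset_span ⟨t, rfl⟩
    exact hmap (Submodule.mem_map_of_mem u.2)
  have h1 : finrank K (LinearMap.range Ψ') ≤ Fintype.card T :=
    (Submodule.finrank_mono hrange).trans (finrank_range_le_card φ)
  -- (2) the kernel of `Ψ'` embeds in the kernel of `Ψ`
  set g : LinearMap.ker Ψ' →ₗ[K] V := U.subtype.comp (LinearMap.ker Ψ').subtype with hgdef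
  have hginj : Function.Injective g :=
    Subtype.val_injective.comp Subtype.val_injective
  have hgrange : LinearMap.range g ≤ LinearMap.ker Ψ := by
    rintro _ ⟨w, rfl⟩
    have hw : Ψ' w.1 = 0 := w.2
    show Ψ ((w.1 : U) : V) = 0
    exact hw
  have h2 : finrank K (LinearMap.ker Ψ') ≤ finrank K (LinearMap.ker Ψ) := by
    rw [← LinearMap.finrank_range_of_inj hginj]
    exact Submodule.finrank_mono hgrange
  -- (3) rank–nullity for `Ψ` itself
  have hrnΨ := LinearMap.finrank_range_add_finrank_ker Ψ
  rw [LinearMap.range_eq_top.mpr hΨ, finrank_top, Module.finrank_fintype_fun_eq_card] at hrnΨ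
  omega

/-! ## The family Neumann counts -/

section Family

/-- The simultaneous separation clause of the route in `if … then 1 else 0` form. -/
theorem sep_ite {G : Type} [Group G] {ι : Type} [DecidableEq G] [DecidableEq ι]
    {J : Submodule ℂ (G → ℂ)}
    {X Y Z : ι → Finset G}
    (h : ∀ i : ι, ∀ x₀ ∈ X i, ∀ z₀ ∈ Z i, ∃ f ∈ J, ∀ a b : ι, ∀ x ∈ X a, ∀ y ∈ Y a, ∀ y' ∈ Y b,
      ∀ z ∈ Z b, ((a = i ∧ b = i ∧ x = x₀ ∧ y = y' ∧ z = z₀) → f (x⁻¹ * y * y'⁻¹ * z) = 1) ∧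
        (¬ (a = i ∧ b = i ∧ x = x₀ ∧ y = y' ∧ z = z₀) → f (x⁻¹ * y * y'⁻¹ * z) = 0))
    (i : ι) {x₀ : G} (hx₀ : x₀ ∈ X i) {z₀ : G} (hz₀ : z₀ ∈ Z i) :
    ∃ f : J, ∀ a b : ι, ∀ x ∈ X a, ∀ y ∈ Y a, ∀ y' ∈ Y b, ∀ z ∈ Z b,
      (f : G → ℂ) (x⁻¹ * y * y'⁻¹ * z) =
        if (a = i ∧ b = i ∧ x = x₀ ∧ y = y' ∧ z = z₀) then 1 else 0 := by
  obtain ⟨f, hf, hspec⟩ := h i x₀ hx₀ z₀ hz₀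
  refine ⟨⟨f, hf⟩, fun a b x hx y hy y' hy' z hz => ?_⟩
  obtain ⟨h1, h0⟩ := hspec a b x hx y hy y' hy' z hz
  split_ifs with hc
  · exact h1 hc
  · exact h0 hc

/-- The row index set `⨆_a X_a × Z_a` (all targets of all blocks) has `Σ_a |X_a||Z_a|` elements. -/
theorem card_rows {G : Type} {ι : Type} [Fintype ι] (X Z : ι → Finset G) :
    Fintype.card ↥((Finset.univ : Finset ι).sigma fun a => X a ×ˢ Z a) = ∑ a, (X a).card * (Z a).card := by
  rw [Fintype.card_coe, Finset.card_sigma]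
  exact Finset.sum_congr rfl fun a _ => Finset.card_product _ _

/-- Membership in the row index set, unfolded. -/
theorem mem_rows {G : Type} {ι : Type} [Fintype ι] {X Z : ι → Finset G}
    (r : ↥((Finset.univ : Finset ι).sigma fun a => X a ×ˢ Z a)) : r.1.2.1 ∈ X r.1.1 ∧ r.1.2.2 ∈ Z r.1.1 := by
  have h := r.2
  rw [Finset.mem_sigma, Finset.mem_product] at h
  exact h.2

/-- **The separators are linearly independent** (one per target, over all blocks; needs every
`Y_a` non-empty): evaluate a vanishing combination at the target word `x₀⁻¹ y y⁻¹ z₀`. -/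
theorem separators_linearIndependent {G : Type} [Group G] {ι : Type} [Fintype ι] [DecidableEq G]
    [DecidableEq ι]
    {J : Submodule ℂ (G → ℂ)} {X Y Z : ι → Finset G}
    (hY : ∀ i, (Y i).Nonempty) (f : ↥((Finset.univ : Finset ι).sigma fun a => X a ×ˢ Z a) → J)
    (hf : ∀ r : ↥((Finset.univ : Finset ι).sigma fun a => X a ×ˢ Z a), ∀ a b : ι, ∀ x ∈ X a, ∀ y ∈ Y a, ∀ y' ∈ Y b, ∀ z ∈ Z b,
      (f r : G → ℂ) (x⁻¹ * y * y'⁻¹ * z) =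
        if (a = r.1.1 ∧ b = r.1.1 ∧ x = r.1.2.1 ∧ y = y' ∧ z = r.1.2.2) then 1 else 0) :
    LinearIndependent ℂ f := by
  rw [linearIndependent_iff']
  intro s c hrel r₀ hr₀
  obtain ⟨hx₀, hz₀⟩ := mem_rows r₀
  obtain ⟨y, hy⟩ := hY r₀.1.1
  -- evaluate at the target word of `r₀`
  have key := congrArg (fun φ : J => (φ : G → ℂ) (r₀.1.2.1⁻¹ * y * y⁻¹ * r₀.1.2.2)) hrel
  simp only [Submodule.coe_sum, Submodule.coe_smul, Finset.sum_apply, Pi.smul_apply,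
    smul_eq_mul, Submodule.coe_zero, Pi.zero_apply] at key
  have hterm : ∀ r ∈ s, c r * (f r : G → ℂ) (r₀.1.2.1⁻¹ * y * y⁻¹ * r₀.1.2.2) =
      if r = r₀ then c r else 0 := by
    intro r _
    rw [hf r r₀.1.1 r₀.1.1 _ hx₀ y hy y hy _ hz₀]
    by_cases hrr : r = r₀
    · subst hrr; simp
    · rw [if_neg hrr, if_neg, mul_zero]
      rintro ⟨ha, -, hx, -, hz⟩
      apply hrr
      obtain ⟨⟨a, x, z⟩, hr⟩ := r
      obtain ⟨⟨a₀, x₀, z₀⟩, hr₀'⟩ := r₀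
      simp only at ha hx hz
      subst ha; subst hx; subst hz
      rfl
  rw [Finset.sum_congr rfl hterm, Finset.sum_ite_eq' s r₀, if_pos hr₀] at key
  exact key

/-- **Family Neumann count, Z-form.**  If `J` is left-translation invariant and the family
`(X_i, Y_i, Z_i)` with all `X_i, Y_i` non-empty is simultaneously `J`-separated, then for every block
`i₀`:  `Σ_i |Y_i||Z_i| + Σ_i |Z_i||X_i| ≤ dim J + |Z_{i₀}|`. -/
theorem familyNeumann_Z {G : Type} [Group G] {ι : Type} [Fintype G] [Fintype ι]
    (J : Submodule ℂ (G → ℂ))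
    (hJ : ∀ f ∈ J, ∀ a : G, (fun g : G => f (a * g)) ∈ J)
    (X Y Z : ι → Finset G) (hX : ∀ i, (X i).Nonempty) (hY : ∀ i, (Y i).Nonempty)
    (hsep : ∀ i : ι, ∀ x₀ ∈ X i, ∀ z₀ ∈ Z i, ∃ f ∈ J, ∀ a b : ι, ∀ x ∈ X a, ∀ y ∈ Y a,
      ∀ y' ∈ Y b, ∀ z ∈ Z b,
        ((a = i ∧ b = i ∧ x = x₀ ∧ y = y' ∧ z = z₀) → f (x⁻¹ * y * y'⁻¹ * z) = 1) ∧
        (¬ (a = i ∧ b = i ∧ x = x₀ ∧ y = y' ∧ z = z₀) → f (x⁻¹ * y * y'⁻¹ * z) = 0))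
    (i₀ : ι) :
    ∑ i, (Y i).card * (Z i).card + ∑ i, (Z i).card * (X i).card ≤
      Module.finrank ℂ J + (Z i₀).card := by
  classical
  obtain ⟨x₁, hx₁⟩ := hX i₀
  obtain ⟨y₁, hy₁⟩ := hY i₀
  -- separators, one per row
  have hrow : ∀ r : ↥((Finset.univ : Finset ι).sigma fun a => X a ×ˢ Z a), ∃ f : J, ∀ a b : ι, ∀ x ∈ X a, ∀ y ∈ Y a, ∀ y' ∈ Y b, ∀ z ∈ Z b,
      (f : G → ℂ) (x⁻¹ * y * y'⁻¹ * z) =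
        if (a = r.1.1 ∧ b = r.1.1 ∧ x = r.1.2.1 ∧ y = y' ∧ z = r.1.2.2) then 1 else 0 :=
    fun r => sep_ite hsep r.1.1 (mem_rows r).1 (mem_rows r).2
  choose f hf using hrow
  have hlin : LinearIndependent ℂ f := separators_linearIndependent hY f hf
  -- columns: `C = ⨆_b Y_b × Z_b`, functionals `ψ_c(φ) = φ (x₁⁻¹ y₁ y'⁻¹ z)`
  let C : Type := ↥((Finset.univ : Finset ι).sigma fun b => Y b ×ˢ Z b)
  have memC : ∀ c : C, c.1.2.1 ∈ Y c.1.1 ∧ c.1.2.2 ∈ Z c.1.1 := fun c => by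
    have h := c.2
    rw [Finset.mem_sigma, Finset.mem_product] at h
    exact h.2
  let Ψ : J →ₗ[ℂ] (C → ℂ) := LinearMap.pi fun c : C =>
    (LinearMap.proj (x₁⁻¹ * y₁ * c.1.2.1⁻¹ * c.1.2.2) : (G → ℂ) →ₗ[ℂ] ℂ).comp J.subtype
  have hΨ : ∀ (φ : J) (c : C), Ψ φ c = (φ : G → ℂ) (x₁⁻¹ * y₁ * c.1.2.1⁻¹ * c.1.2.2) :=
    fun φ c => rfl
  -- `Ψ` is onto: hit every coordinate vector by a left translate of a separator
  have hsingle : ∀ c' : C, ∃ φ : J, Ψ φ = fun c => if c = c' then 1 else 0 := by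
    intro c'
    obtain ⟨hy'', hz'⟩ := memC c'
    obtain ⟨x₀, hx₀⟩ := hX c'.1.1
    obtain ⟨f', hf'⟩ := sep_ite hsep c'.1.1 hx₀ hz'
    refine ⟨⟨fun h => (f' : G → ℂ) (x₀⁻¹ * c'.1.2.1 * (x₁⁻¹ * y₁)⁻¹ * h), hJ _ f'.2 _⟩, ?_⟩
    funext c
    obtain ⟨hy', hz⟩ := memC c
    rw [hΨ]
    have harg : x₀⁻¹ * c'.1.2.1 * (x₁⁻¹ * y₁)⁻¹ * (x₁⁻¹ * y₁ * c.1.2.1⁻¹ * c.1.2.2) =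
        x₀⁻¹ * c'.1.2.1 * c.1.2.1⁻¹ * c.1.2.2 := by group
    simp only [harg]
    rw [hf' c'.1.1 c.1.1 x₀ hx₀ _ hy'' _ hy' _ hz]
    by_cases hcc : c = c'
    · subst hcc; simp
    · rw [if_neg hcc, if_neg]
      rintro ⟨-, hb, -, hy, hz2⟩
      apply hcc
      obtain ⟨⟨b, y', z⟩, hc⟩ := c
      obtain ⟨⟨b', y'', z'⟩, hc'⟩ := c'
      simp only at hb hy hz2
      subst hb; subst hy; subst hz2
      rfl
  have hsurj : Function.Surjective Ψ := by
    intro w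
    choose φ hφ using hsingle
    refine ⟨∑ c, w c • φ c, ?_⟩
    rw [map_sum]
    funext c₀
    simp only [map_smul, Finset.sum_apply, Pi.smul_apply, hφ, smul_eq_mul, mul_ite, mul_one,
      mul_zero]
    rw [Finset.sum_ite_eq]
    simp

  -- the images of the separators: zero unless the row is `(i₀, x₁, z₀)`
  let T : Type := ↥(Z i₀)
  have memT : ∀ t : T, (⟨i₀, (x₁, (t : G))⟩ : Σ _ : ι, G × G) ∈
      (Finset.univ : Finset ι).sigma (fun a => X a ×ˢ Z a) := fun t => by
    rw [Finset.mem_sigma, Finset.mem_product]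
    exact ⟨Finset.mem_univ _, hx₁, t.2⟩
  let φT : T → (C → ℂ) := fun t => Ψ (f ⟨⟨i₀, (x₁, (t : G))⟩, memT t⟩)
  have hφ : ∀ r, Ψ (f r) = 0 ∨ ∃ t, Ψ (f r) = φT t := by
    intro r
    obtain ⟨hxr, hzr⟩ := mem_rows r
    by_cases hri : r.1.1 = i₀ ∧ r.1.2.1 = x₁
    · right
      obtain ⟨hri₀, hrx⟩ := hri
      refine ⟨⟨r.1.2.2, hri₀ ▸ hzr⟩, ?_⟩
      obtain ⟨⟨a, x, z⟩, hr⟩ := r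
      simp only at hri₀ hrx
      subst hri₀; subst hrx
      rfl
    · left
      funext c
      obtain ⟨hy', hz⟩ := memC c
      rw [hΨ, hf r i₀ c.1.1 x₁ hx₁ y₁ hy₁ _ hy' _ hz, Pi.zero_apply, if_neg]
      rintro ⟨ha, -, hx, -, -⟩
      exact hri ⟨ha.symm, hx.symm⟩
  have hcore := rank_core f hlin Ψ hsurj φT hφ
  have hC : Fintype.card C = ∑ b, (Y b).card * (Z b).card := by
    exact card_rows Y Z
  have hT : Fintype.card T = (Z i₀).card := Fintype.card_coe _
  rw [card_rows, hC, hT] at hcore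
  have hcomm : ∑ i, (Z i).card * (X i).card = ∑ a, (X a).card * (Z a).card :=
    Finset.sum_congr rfl fun a _ => Nat.mul_comm _ _
  omega

/-- **Family Neumann count, X-form.**  If `J` is right-translation invariant and the family
`(X_i, Y_i, Z_i)` with all `Y_i, Z_i` non-empty is simultaneously `J`-separated, then for every block
`i₀`:  `Σ_i |X_i||Y_i| + Σ_i |Z_i||X_i| ≤ dim J + |X_{i₀}|`. -/
theorem familyNeumann_X {G : Type} [Group G] {ι : Type} [Fintype G] [Fintype ι]
    (J : Submodule ℂ (G → ℂ))
    (hJ : ∀ f ∈ J, ∀ b : G, (fun g : G => f (g * b)) ∈ J)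
    (X Y Z : ι → Finset G) (hY : ∀ i, (Y i).Nonempty) (hZ : ∀ i, (Z i).Nonempty)
    (hsep : ∀ i : ι, ∀ x₀ ∈ X i, ∀ z₀ ∈ Z i, ∃ f ∈ J, ∀ a b : ι, ∀ x ∈ X a, ∀ y ∈ Y a,
      ∀ y' ∈ Y b, ∀ z ∈ Z b,
        ((a = i ∧ b = i ∧ x = x₀ ∧ y = y' ∧ z = z₀) → f (x⁻¹ * y * y'⁻¹ * z) = 1) ∧
        (¬ (a = i ∧ b = i ∧ x = x₀ ∧ y = y' ∧ z = z₀) → f (x⁻¹ * y * y'⁻¹ * z) = 0))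
    (i₀ : ι) :
    ∑ i, (X i).card * (Y i).card + ∑ i, (Z i).card * (X i).card ≤
      Module.finrank ℂ J + (X i₀).card := by
  classical
  obtain ⟨y₁, hy₁⟩ := hY i₀
  obtain ⟨z₁, hz₁⟩ := hZ i₀
  have hrow : ∀ r : ↥((Finset.univ : Finset ι).sigma fun a => X a ×ˢ Z a), ∃ f : J, ∀ a b : ι, ∀ x ∈ X a, ∀ y ∈ Y a, ∀ y' ∈ Y b, ∀ z ∈ Z b,
      (f : G → ℂ) (x⁻¹ * y * y'⁻¹ * z) =
        if (a = r.1.1 ∧ b = r.1.1 ∧ x = r.1.2.1 ∧ y = y' ∧ z = r.1.2.2) then 1 else 0 :=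
    fun r => sep_ite hsep r.1.1 (mem_rows r).1 (mem_rows r).2
  choose f hf using hrow
  have hlin : LinearIndependent ℂ f := separators_linearIndependent hY f hf
  -- columns: `C = ⨆_a X_a × Y_a`, functionals `ψ_c(φ) = φ (x⁻¹ y · y₁⁻¹ z₁)`
  let C : Type := ↥((Finset.univ : Finset ι).sigma fun a => X a ×ˢ Y a)
  have memC : ∀ c : C, c.1.2.1 ∈ X c.1.1 ∧ c.1.2.2 ∈ Y c.1.1 := fun c => by
    have h := c.2
    rw [Finset.mem_sigma, Finset.mem_product] at h
    exact h.2
  let Ψ : J →ₗ[ℂ] (C → ℂ) := LinearMap.pi fun c : C =>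
    (LinearMap.proj (c.1.2.1⁻¹ * c.1.2.2 * y₁⁻¹ * z₁) : (G → ℂ) →ₗ[ℂ] ℂ).comp J.subtype
  have hΨ : ∀ (φ : J) (c : C), Ψ φ c = (φ : G → ℂ) (c.1.2.1⁻¹ * c.1.2.2 * y₁⁻¹ * z₁) :=
    fun φ c => rfl
  have hsingle : ∀ c' : C, ∃ φ : J, Ψ φ = fun c => if c = c' then 1 else 0 := by
    intro c'
    obtain ⟨hx', hy''⟩ := memC c'
    obtain ⟨z', hz'⟩ := hZ c'.1.1
    obtain ⟨f', hf'⟩ := sep_ite hsep c'.1.1 hx' hz'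
    refine ⟨⟨fun h => (f' : G → ℂ) (h * ((y₁⁻¹ * z₁)⁻¹ * (c'.1.2.2⁻¹ * z'))), hJ _ f'.2 _⟩, ?_⟩
    funext c
    obtain ⟨hx, hy⟩ := memC c
    rw [hΨ]
    have harg : c.1.2.1⁻¹ * c.1.2.2 * y₁⁻¹ * z₁ * ((y₁⁻¹ * z₁)⁻¹ * (c'.1.2.2⁻¹ * z')) =
        c.1.2.1⁻¹ * c.1.2.2 * c'.1.2.2⁻¹ * z' := by group
    simp only [harg]
    rw [hf' c.1.1 c'.1.1 _ hx _ hy _ hy'' _ hz']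
    by_cases hcc : c = c'
    · subst hcc; simp
    · rw [if_neg hcc, if_neg]
      rintro ⟨ha, -, hx2, hy2, -⟩
      apply hcc
      obtain ⟨⟨a, x, y⟩, hc⟩ := c
      obtain ⟨⟨a', x', y''⟩, hc'⟩ := c'
      simp only at ha hx2 hy2
      subst ha; subst hx2; subst hy2
      rfl
  have hsurj : Function.Surjective Ψ := by
    intro w
    choose φ hφ using hsingle
    refine ⟨∑ c, w c • φ c, ?_⟩
    rw [map_sum]
    funext c₀
    simp only [map_smul, Finset.sum_apply, Pi.smul_apply, hφ, smul_eq_mul, mul_ite, mul_one,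
      mul_zero]
    rw [Finset.sum_ite_eq]
    simp

  let T : Type := ↥(X i₀)
  have memT : ∀ t : T, (⟨i₀, ((t : G), z₁)⟩ : Σ _ : ι, G × G) ∈
      (Finset.univ : Finset ι).sigma (fun a => X a ×ˢ Z a) := fun t => by
    rw [Finset.mem_sigma, Finset.mem_product]
    exact ⟨Finset.mem_univ _, t.2, hz₁⟩
  let φT : T → (C → ℂ) := fun t => Ψ (f ⟨⟨i₀, ((t : G), z₁)⟩, memT t⟩)
  have hφ : ∀ r, Ψ (f r) = 0 ∨ ∃ t, Ψ (f r) = φT t := by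
    intro r
    obtain ⟨hxr, hzr⟩ := mem_rows r
    by_cases hri : r.1.1 = i₀ ∧ r.1.2.2 = z₁
    · right
      obtain ⟨hri₀, hrz⟩ := hri
      refine ⟨⟨r.1.2.1, hri₀ ▸ hxr⟩, ?_⟩
      obtain ⟨⟨a, x, z⟩, hr⟩ := r
      simp only at hri₀ hrz
      subst hri₀; subst hrz
      rfl
    · left
      funext c
      obtain ⟨hx, hy⟩ := memC c
      rw [hΨ, hf r c.1.1 i₀ _ hx _ hy y₁ hy₁ z₁ hz₁, Pi.zero_apply, if_neg]
      rintro ⟨-, hb, -, -, hz⟩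
      exact hri ⟨hb.symm, hz.symm⟩
  have hcore := rank_core f hlin Ψ hsurj φT hφ
  have hC : Fintype.card C = ∑ a, (X a).card * (Y a).card := by
    exact card_rows X Y
  have hT : Fintype.card T = (X i₀).card := Fintype.card_coe _
  rw [card_rows, hC, hT] at hcore
  have hcomm : ∑ i, (Z i).card * (X i).card = ∑ a, (X a).card * (Z a).card :=
    Finset.sum_congr rfl fun a _ => Nat.mul_comm _ _
  omega

end Family

end Summit.MatrixMultiplication.MatrixMultiplication.Theorems.GradedDesignFamily.Negative

end
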